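import Literature.NumberTheory.LFunctions.ClassGroupLFunctionConvexity
import HarnessLib

/-!
# `L(s, χ)` is entire for a non-trivial class group character

Topic `Literature/NumberTheory/LFunctions` (namespace `Literature.NumberTheory.LFunctions.NumberField`),
continuing `ClassGroupLFunctionConvexity.lean` (`Z₁_a(s) = Σ_C a(C) E_C(s) = (s − 1) Z_a(s)`, entire).
Everything here is PROVED (one definition with body, theorems).

The residue of the class partial zeta function `ζ(C, s)` at `s = 1` does not depend on the class
(Neukirch VII (5.11) (ii): `2^{r₁}(2π)^{r₂} R/(w √|d_K|)` for every `𝔎`).  In the tree's explicit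
continuation this is the statement that `E_C(1) = 2 ε_C B_C(1)` is independent of `C`
(`classSumEntire_one_eq`: the norm `N(J_C)` of the representative cancels between
`ε_C = (N(J_C) √|d_K|)⁻¹` and `B_C(1) = c_K⁻¹ w⁻¹ N(J_C) A(1/2)⁻¹`).  Consequently
`Z₁_a(1) = κ_K Σ_C a(C)` (`classTwistedZeta₁_one`), which vanishes for a non-trivial character
(`sum_classGroupChar_eq_zero`, `classTwistedZeta₁_one_eq_zero`), so that

* `classGroupLFunction₀ K χ = dslope Z₁_χ 1` is ENTIRE (`differentiable_classGroupLFunction₀`) and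
  equals `L(s, χ)` off `s = 1` (`classGroupLFunction₀_eq`): **the `L`-function of a non-trivial
  class group character is entire** ("`L(s, χ)` has a simple pole at `s = 1` iff `χ` is trivial",
  [ThornerZaman2019, §2.3]; Neukirch VII (8.5)), closing the gap flagged in the docstring of
  `classGroupLFunction` (`UniformClassGroupPNT.lean`).

## References

* J. Neukirch, *Algebraic Number Theory*, Springer 1999, Ch. VII (5.11), (8.5). [NeukirchANT1999]
* J. Thorner, A. Zaman, *A unified and improved Chebotarev density theorem*, ANT 13 (2019), §2.3.
  [ThornerZaman2019]
-/

noncomputable section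

open scoped NumberField nonZeroDivisors
open NumberField NumberField.InfinitePlace NumberField.Units Complex Filter Topology Set

namespace Literature.NumberTheory.LFunctions.NumberField

variable {K : Type*} [Field K] [NumberField K]

/-! ### The value `E_C(1)` does not depend on the class -/

/-- **`E_C(1) = 2 c_K⁻¹ w⁻¹ A(1/2)⁻¹ |d_K|^{-1/2}` for every class `C`** (the residue of `ζ(C, s)`
at `s = 1` is class-independent, Neukirch VII (5.11) (ii)): `E_C(1) = 2 ε_C B_C(1)` and `N(J_C)`
cancels. [cite: NeukirchANT1999, Ch. VII (5.11)] -/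
theorem classSumEntire_one_eq (hinv : thetaIdeal_inv K) (C : ClassGroup (𝓞 K)) :
    classSumEntire hinv C 1 =
      2 * (((heckeCst K : ℂ))⁻¹ * ((torsionOrder K : ℂ))⁻¹ * (gammaFactorC K (1 / 2))⁻¹ *
        Complex.exp (-((Real.log ((discr K).natAbs) : ℂ) / 2))) := by
  have hnC : (0 : ℝ) < Ideal.absNorm (classRep K C : Ideal (𝓞 K)) :=
    Nat.cast_pos.mpr (Ideal.absNorm_pos_of_nonZeroDivisors (classRep K C))
  rw [classSumEntire, classPair_ε_eq_exp hinv C, classFrontFactor, sub_self, zero_mul, zero_mul,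
    zero_add, sub_zero, Complex.cpow_one]
  have hN : ((Ideal.absNorm ((classRep K C : (Ideal (𝓞 K))⁰) : Ideal (𝓞 K)) : ℂ)) =
      Complex.exp ((Real.log (Ideal.absNorm (classRep K C : Ideal (𝓞 K))) : ℂ)) := by
    rw [← Complex.ofReal_exp, Real.exp_log hnC, Complex.ofReal_natCast]
  rw [hN, neg_add, Complex.exp_add]
  have hcancel : Complex.exp ((Real.log (Ideal.absNorm (classRep K C : Ideal (𝓞 K))) : ℂ)) *
      Complex.exp (-((Real.log (Ideal.absNorm (classRep K C : Ideal (𝓞 K))) : ℂ))) = 1 := by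
    rw [← Complex.exp_add, add_neg_cancel, Complex.exp_zero]
  have : -((Real.log ((discr K).natAbs) : ℂ) / 2) = -((Real.log ((discr K).natAbs) : ℂ)) / 2 := by ring
  rw [neg_div] at *
  linear_combination (((heckeCst K : ℂ))⁻¹ * ((torsionOrder K : ℂ))⁻¹ * (gammaFactorC K (1 / 2))⁻¹ *
    2 * Complex.exp (-((Real.log ((discr K).natAbs) : ℂ) / 2))) * hcancel

/-- **`Z₁_a(1) = κ_K · Σ_C a(C)`** with the class-independent `κ_K = E_C(1)`. [folklore] -/
theorem classTwistedZeta₁_one (a : ClassGroup (𝓞 K) → ℂ) :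
    classTwistedZeta₁ K a 1 =
      (2 * (((heckeCst K : ℂ))⁻¹ * ((torsionOrder K : ℂ))⁻¹ * (gammaFactorC K (1 / 2))⁻¹ *
        Complex.exp (-((Real.log ((discr K).natAbs) : ℂ) / 2)))) * ∑ C : ClassGroup (𝓞 K), a C := by
  rw [classTwistedZeta₁, Finset.mul_sum]
  refine Finset.sum_congr rfl fun C _ ↦ ?_
  rw [classSumEntire_one_eq]
  ring

/-- **Orthogonality: `Σ_C χ(C) = 0` for a non-trivial character** `χ : Cl_K →* ℂˣ` (translate by
`g` with `χ(g) ≠ 1`). [folklore] -/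
theorem sum_classGroupChar_eq_zero {χ : ClassGroup (𝓞 K) →* ℂˣ} (hχ : χ ≠ 1) :
    ∑ C : ClassGroup (𝓞 K), (χ C : ℂ) = 0 := by
  obtain ⟨g, hg⟩ : ∃ g, χ g ≠ 1 := by
    by_contra h
    refine hχ (MonoidHom.ext fun C ↦ ?_)
    by_contra hC
    exact h ⟨C, hC⟩
  have hsum : ∑ C : ClassGroup (𝓞 K), (χ C : ℂ) = ∑ C : ClassGroup (𝓞 K), (χ (g * C) : ℂ) :=
    (Fintype.sum_equiv (Equiv.mulLeft g) _ _ fun C ↦ rfl).symm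
  have h2 : ∑ C : ClassGroup (𝓞 K), (χ (g * C) : ℂ) = (χ g : ℂ) * ∑ C : ClassGroup (𝓞 K), (χ C : ℂ) := by
    rw [Finset.mul_sum]
    exact Finset.sum_congr rfl fun C _ ↦ by rw [map_mul, Units.val_mul]
  have hg' : (χ g : ℂ) ≠ 1 := fun h ↦ hg (Units.val_eq_one.mp h)
  have h3 : ((χ g : ℂ) - 1) * ∑ C : ClassGroup (𝓞 K), (χ C : ℂ) = 0 := by
    rw [sub_mul, one_mul, ← h2, ← hsum, sub_self]
  exact (mul_eq_zero.mp h3).resolve_left (sub_ne_zero.mpr hg')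

/-- `Z₁_χ(1) = 0` for a non-trivial class group character. [folklore] -/
theorem classTwistedZeta₁_one_eq_zero {χ : ClassGroup (𝓞 K) →* ℂˣ} (hχ : χ ≠ 1) :
    classTwistedZeta₁ K (fun C ↦ (χ C : ℂ)) 1 = 0 := by
  rw [classTwistedZeta₁_one, sum_classGroupChar_eq_zero hχ, mul_zero]

/-! ### The entire `L`-function of a non-trivial character -/

variable (K) in
/-- **The entire `L`-function of a class group character**: `L₀(s, χ) = dslope Z₁_χ 1 (s)`, i.e.
`Z₁_χ(s)/(s − 1) = L(s, χ)` off `s = 1` and `Z₁_χ'(1)` at `s = 1`.  For `χ ≠ 1` it is entire and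
agrees with `classGroupLFunction K χ` off `s = 1` (`classGroupLFunction₀_eq`), realising
"`L(s, χ)` has a simple pole at `s = 1` iff `χ` is trivial" ([ThornerZaman2019, §2.3]).
[cite: NeukirchANT1999, Ch. VII (8.5)] -/
def classGroupLFunction₀ (χ : ClassGroup (𝓞 K) →* ℂˣ) : ℂ → ℂ :=
  dslope (classTwistedZeta₁ K (fun C ↦ (χ C : ℂ))) 1

/-- `L₀(s, χ) = L(s, χ)` for `s ≠ 1`. [folklore] -/
theorem classGroupLFunction₀_eq (χ : ClassGroup (𝓞 K) →* ℂˣ) {s : ℂ} (hs : s ≠ 1)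
    (hχ : χ ≠ 1) : classGroupLFunction₀ K χ s = classGroupLFunction K χ s := by
  rw [classGroupLFunction₀, dslope_of_ne _ hs, slope, classTwistedZeta₁_one_eq_zero hχ, vsub_eq_sub,
    sub_zero, ← sub_one_mul_classGroupLFunction χ hs, smul_eq_mul]
  field_simp [sub_ne_zero.mpr hs]

/-- **`L(s, χ)` is entire for `χ ≠ 1`**: `L₀(·, χ)` is differentiable on `ℂ` (Mathlib's
power series of `dslope`, `HasFPowerSeriesAt.has_fpower_series_dslope_fslope`, and
`differentiableAt_dslope_of_ne`, for the entire `Z₁_χ`).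
[cite: NeukirchANT1999, Ch. VII (8.5)] -/
theorem differentiable_classGroupLFunction₀ (χ : ClassGroup (𝓞 K) →* ℂˣ) :
    Differentiable ℂ (classGroupLFunction₀ K χ) := by
  intro s
  have hd := differentiable_classTwistedZeta₁ (K := K) (fun C ↦ (χ C : ℂ))
  by_cases hs : s = 1
  · subst hs
    obtain ⟨p, hp⟩ := hd.analyticAt 1
    exact hp.has_fpower_series_dslope_fslope.analyticAt.differentiableAt
  · rw [classGroupLFunction₀, differentiableAt_dslope_of_ne hs]
    exact hd s

/-- The value at `s = 1`: `L₀(1, χ) = Z₁_χ'(1)`. [folklore] -/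
theorem classGroupLFunction₀_one (χ : ClassGroup (𝓞 K) →* ℂˣ) :
    classGroupLFunction₀ K χ 1 = deriv (classTwistedZeta₁ K (fun C ↦ (χ C : ℂ))) 1 := by
  rw [classGroupLFunction₀, dslope_same]

end Literature.NumberTheory.LFunctions.NumberField

end
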